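import Summits.CriticalPhenomena.PercolationContinuityZ3.Theorems.PercNearOneGluingNoHeavyQuantGreedyRowLemma
import HarnessLib

/-!
# QUANT lane R8, T-DEC: THEOREM G — the SW greedy credit flow is OPTIMAL on a Monge staircase, for every prefix of columns at once
# (lead g25, `run/shared/lean/prim/quant/FOR-PROVERS-WINDOW-ATOMS.md` §2; Lean plan W2, final part)

builds on p205010 (kernel theorem, internal audit signed; external expert review pending)

Support file (`--supports stmt-CriticalPhenomena-4575`), QUANT lane lead seat (gen 25), rung R8 of
`run/shared/lean/prim/quant/LADDER.md`.  Theorems only, standard axioms, no sorries.  Assembles `…QuantGreedyFlow` (definitions, validity,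
prefix property), `…QuantGreedyExchange` (truncation / uncrossing) and `…QuantGreedyRowLemma` (the top row must be left-packed).

THEOREM G.  Rows and columns are naturals; the compatibility `P` is up-closed in the column; the rates `u` are positive on compatible cells,
ANTITONE in the row (`l < l′` in `L`, `P l h` ⟹ `u l′ h ≤ u l h`) and MONGE (`l < l′` in `L`, `h < k`, `P l h` ⟹ `u l′ h·u l k ≤ u l h·u l′ k`) — for the DEC
rates these are lead g21's `LawDec.usage_anti_low` and `LawDec.usage_monge`.  Then for nonnegative masses and capacities:
* **`Greedy.val_le_gval`** — every credit flow ships at most as much as the SW greedy flow (induction on the rows via the row lemma);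
* **`Greedy.val_le_sum_flow_prefix`** — every credit flow into the columns `{h ∈ H : h ≤ t}` ships at most as much as the greedy flow of the
  FULL problem puts into those columns (prefix property `flow_prefix`): ONE flow is simultaneously optimal for all prefixes.  This is the
  "universal greedy" of the window-atom decomposition (W3/W4: pool reduction and ballot form turn it into `LawDec.WindowAtomDecomposition`).

[this work]; corner rules for Monge arrays: Hoffman 1963 (classical).  The gluing rows served [cite: KozmaNitzan2024, Conjecture 3 (p. 15)];
product measure [cite: Grimmett1999, §1.3 p. 10].
-/

noncomputable section
namespace Summit.CriticalPhenomena.PercolationContinuityZ3.Theorems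
namespace Quant
namespace LawDec
namespace Greedy

open Finset
variable (u : ℕ → ℕ → ℝ) (P : ℕ → ℕ → Prop) [DecidableRel P]

/-- **THEOREM G (optimality of the SW greedy credit flow).** [this work] -/
theorem val_le_gval (hu : ∀ l h, P l h → 0 < u l h) (hPh : ∀ l h k, h ≤ k → P l h → P l k) :
    ∀ (L H : Finset ℕ) (μ c : ℕ → ℝ),
      (∀ l ∈ L, ∀ l' ∈ L, ∀ h, l < l' → P l h → u l' h ≤ u l h) →
      (∀ l ∈ L, ∀ l' ∈ L, ∀ h k, l < l' → h < k → P l h → u l' h * u l k ≤ u l h * u l' k) →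
      (∀ l ∈ L, 0 ≤ μ l) → (∀ h ∈ H, 0 ≤ c h) →
      ∀ f : ℕ → ℕ → ℝ, IsFlow u P L H μ c f → val L H f ≤ gval u P L H μ c := by
  intro L
  induction L using Finset.strongInduction with
  | H L ih =>
    intro H μ c hanti hmonge hμ hc f hf
    by_cases hL : L.Nonempty
    swap
    · rw [Finset.not_nonempty_iff_eq_empty.1 hL]; simp [val, gval]
    set l₀ := L.max' hL with hl₀def
    have hl₀ : l₀ ∈ L := by rw [hl₀def]; exact Finset.max'_mem L hL
    have hlt : ∀ l ∈ L.erase l₀, l < l₀ := fun l hl => by rw [hl₀def]; exact Finset.lt_max'_of_mem_erase_max' L hL hl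
    have hμ' : ∀ l ∈ L.erase l₀, 0 ≤ μ l := fun l hl => hμ l (Finset.mem_of_mem_erase hl)
    -- optimality for the smaller rows, every capacity
    have hopt : ∀ c' : ℕ → ℝ, (∀ h ∈ H, 0 ≤ c' h) → ∀ f', IsFlow u P (L.erase l₀) H μ c' f' →
        val (L.erase l₀) H f' ≤ gval u P (L.erase l₀) H μ c' :=
      fun c' hc' f' hf' => ih _ (Finset.erase_ssubset hl₀) H μ c'
        (fun l hl l' hl' h => hanti l (Finset.mem_of_mem_erase hl) l' (Finset.mem_of_mem_erase hl') h)
        (fun l hl l' hl' h k => hmonge l (Finset.mem_of_mem_erase hl) l' (Finset.mem_of_mem_erase hl') h k) hμ' hc' f' hf'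
    obtain ⟨h0, hsupp, hrow, hcol⟩ := hf
    -- nonnegativity of the loads, and the single-cell capacity bound for the top row
    have hterm : ∀ k l, 0 ≤ u l k * f l k := by
      intro k l
      rcases (h0 l k).eq_or_lt with hz | hpos
      · rw [← hz, mul_zero]
      · exact mul_nonneg (hu _ _ (hsupp l k hpos.ne').2.2).le hpos.le
    have hcap : ∀ k ∈ H, u l₀ k * f l₀ k ≤ c k := fun k hk =>
      le_trans (Finset.single_le_sum (fun l _ => hterm k l) hl₀) (hcol k hk)
    -- split the flow and the greedy at the top row
    have hsplit := val_eq_top_add L H l₀ hl₀ f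
    have hf' := isFlow_erase_top u P L H μ c l₀ hl₀ f ⟨h0, hsupp, hrow, hcol⟩
    have hc1 : ∀ k ∈ H, 0 ≤ c k - u l₀ k * f l₀ k := fun k hk => by linarith [hcap k hk]
    have h1 := hopt _ hc1 _ hf'
    -- the row lemma with `H′ = H`, `rem = μ l₀`, `r = f l₀`
    have h2 := row_lemma u P hu hPh (L.erase l₀) H μ hμ' l₀
      (fun l hl h hP => hanti l (Finset.mem_of_mem_erase hl) l₀ hl₀ h (hlt l hl) hP)
      (fun l hl h k hhk hP => hmonge l (Finset.mem_of_mem_erase hl) l₀ hl₀ h k (hlt l hl) hhk hP) hopt H (subset_refl H) c hc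
      (μ l₀) (hμ l₀ hl₀)
      (fun k => f l₀ k) (fun k => h0 l₀ k) (fun k hk => ⟨(hsupp l₀ k hk).2.1, (hsupp l₀ k hk).2.2⟩) (hrow l₀ hl₀) hcap
    -- the greedy value splits the same way
    have h3 : gval u P L H μ c = (∑ k ∈ H, rowFill u P l₀ k H c (μ l₀)) +
        gval u P (L.erase l₀) H μ (fun h => c h - u l₀ h * rowFill u P l₀ h H c (μ l₀)) := by
      unfold gval; rw [hl₀def]; exact val_flow_eq u P L H hL μ c
    rw [hsplit, h3]
    linarith

/-- **THEOREM G, PREFIX FORM (the universal greedy).**  Every credit flow into the columns `{h ∈ H : h ≤ t}` ships at most as much as the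
greedy flow of the full problem `(L, H)` puts into those columns. [this work] -/
theorem val_le_sum_flow_prefix (hu : ∀ l h, P l h → 0 < u l h) (hPh : ∀ l h k, h ≤ k → P l h → P l k)
    (L H : Finset ℕ) (μ c : ℕ → ℝ)
    (hanti : ∀ l ∈ L, ∀ l' ∈ L, ∀ h, l < l' → P l h → u l' h ≤ u l h)
    (hmonge : ∀ l ∈ L, ∀ l' ∈ L, ∀ h k, l < l' → h < k → P l h → u l' h * u l k ≤ u l h * u l' k)
    (hμ : ∀ l ∈ L, 0 ≤ μ l) (hc : ∀ h ∈ H, 0 ≤ c h) (t : ℕ)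
    (f : ℕ → ℕ → ℝ) (hf : IsFlow u P L (H.filter (· ≤ t)) μ c f) :
    val L (H.filter (· ≤ t)) f ≤ ∑ l ∈ L, ∑ h ∈ H.filter (· ≤ t), flow u P L H μ c l h := by
  have h1 := val_le_gval u P hu hPh L (H.filter (· ≤ t)) μ c hanti hmonge hμ
    (fun h hh => hc h (Finset.mem_of_mem_filter h hh)) f hf
  have h2 : ∑ l ∈ L, ∑ h ∈ H.filter (· ≤ t), flow u P L H μ c l h = gval u P L (H.filter (· ≤ t)) μ c := by
    unfold gval val
    refine Finset.sum_congr rfl fun l _ => Finset.sum_congr rfl fun h hh => ?_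
    exact flow_prefix u P t L H μ c c l h (Finset.mem_filter.1 hh).2 (fun _ _ _ => rfl)
  rw [h2]; exact h1

end Greedy
end LawDec
end Quant
end Summit.CriticalPhenomena.PercolationContinuityZ3.Theorems
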